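import Literature.NumberTheory.Transcendental.MahlerManinLiouvilleStep
import Literature.NumberTheory.Transcendental.QuadraticRelationsLogarithmsWeilHeight
import Mathlib.Analysis.Complex.Basic
import HarnessLib

/-!
# Waldschmidt 1978, Corollary 3.9 (transcendence measure for `e^β`) — proofs, part I:
# Liouville's inequality for an integer polynomial in two algebraic numbers

Sibling PROOFS file of `ExpAlgebraicTranscendenceMeasure.lean` (the named fact
`Literature.NumberTheory.Transcendental.Waldschmidt1978_cor_3_9`). Everything here is PROVED; no
definitions, no named facts.

The arithmetic lower bound of the proof of the approximation measure for `e^β` (Theorem 3.8 of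
[Waldschmidt1978]; here obtained by the method of [NesterenkoWaldschmidt1996], §6 c)) is
Liouville's inequality [NesterenkoWaldschmidt1996, §5, Lemma 5] (Fel'dman 1982, Lemma 9.2) for a
polynomial `f ∈ ℤ[X₁, X₂]` at the point `(β, ξ)` of the number field `𝕜 = ℚ(β, ξ)` of degree `D`:
`log |f(β, ξ)| ≥ −(D−1) log L(f) − D (N₁ h(β) + N₂ h(ξ))`. We prove it in the slightly weaker
form with `D` in place of `D − 1`, and with the polynomial written as a finite sum of monomials
`∑_l a_l β^{e₁ l} ξ^{e₂ l}` indexed by an arbitrary finite set (which is how the interpolation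
determinant expands), from two ingredients:

* `Waldschmidt1978.inv_mulHeight₁_le_norm_embedding` — the **fundamental (Liouville) inequality**
  `‖φ x‖ ≥ H_K(x)⁻¹` for a number field `K`, an embedding `φ : K →+* ℂ` and `x ≠ 0`, where
  `H_K = Height.mulHeight₁` is Mathlib's (relative) multiplicative height: `H_K(x) = H_K(x⁻¹)` is
  a product of factors `≥ 1` one of which is `max(1, ‖φ x‖⁻¹)^{mult}` (the archimedean analogue of
  the tree's `p`-adic `inv_mulHeight₁_le_norm_embedding`, `PadicLiouvilleInequality.lean`);
* the tree's `logHeight₁_sum_intCast_mul_pow_mul_pow_le` (`MahlerManinLiouvilleStep.lean`):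
  `log H_K(∑ a_l α^{e₁ l} β^{e₂ l}) ≤ [K:ℚ] log⁺(∑ |a_l|) + D₁ log H_K(α) + D₂ log H_K(β)`.

The result, `Waldschmidt1978.liouville₂`, is stated for a subfield `F ⊂ ℂ` finite over `ℚ`
containing `β, ξ`, with the tree's absolute logarithmic Weil height `weilHeight₁ F`
(`= logHeight₁ / [F:ℚ]`, `QuadraticRelationsLogarithmsWeilHeight.lean`):
`log |∑ a_l β^{e₁ l} ξ^{e₂ l}| ≥ −[F:ℚ] (log⁺(∑|a_l|) + D₁ h(β) + D₂ h(ξ))`.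

## References

* [NesterenkoWaldschmidt1996] Yu. V. Nesterenko, M. Waldschmidt, Mat. Zapiski 2 (1996) 23–42
  (arXiv:math/0002047), §5 Lemma 5.
* [Waldschmidt1978] M. Waldschmidt, J. Austral. Math. Soc. (A) 25 (1978) 445–465, §3.3.
* M. Waldschmidt, *Diophantine Approximation on Linear Algebraic Groups*, Springer 2000, §3.5.
-/

noncomputable section

open Height NumberField

namespace Literature.NumberTheory.Transcendental

namespace Waldschmidt1978

/-! ### The fundamental inequality `‖φ x‖ ≥ H(x)⁻¹` -/

section numberField

variable {K : Type*} [Field K] [NumberField K]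

/-- **Liouville's inequality (archimedean, relative height).** For a number field `K`, an
embedding `φ : K →+* ℂ` and `x ≠ 0` in `K`: `H_K(x)⁻¹ ≤ ‖φ x‖`, `H_K = Height.mulHeight₁`.
Indeed `H_K(x) = H_K(x⁻¹) = ∏_v max(1, |x⁻¹|_v)^{m_v} · ∏_{w ∤ ∞} max(1, |x⁻¹|_w)`, all factors are
`≥ 1`, and the factor at the place `v` of `φ` is `≥ ‖φ x‖⁻¹`. [folklore] -/
theorem inv_mulHeight₁_le_norm_embedding (φ : K →+* ℂ) {x : K} (hx : x ≠ 0) :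
    (mulHeight₁ x)⁻¹ ≤ ‖φ x‖ := by
  have hφx : φ x ≠ 0 := (map_ne_zero φ).mpr hx
  have hpos : 0 < ‖φ x‖ := norm_pos_iff.mpr hφx
  set w : InfinitePlace K := InfinitePlace.mk φ with hw
  -- the factor at `w` of `H(x⁻¹)`
  have h1 : ‖φ x‖⁻¹ ≤ max (w x⁻¹) 1 ^ w.mult := by
    have e : w x⁻¹ = ‖φ x‖⁻¹ := by rw [hw, InfinitePlace.apply, map_inv₀, norm_inv]
    calc ‖φ x‖⁻¹ = w x⁻¹ := e.symm
      _ ≤ max (w x⁻¹) 1 := le_max_left _ _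
      _ = max (w x⁻¹) 1 ^ 1 := (pow_one _).symm
      _ ≤ max (w x⁻¹) 1 ^ w.mult :=
          pow_le_pow_right₀ (le_max_right _ _) InfinitePlace.mult_pos
  have h2 : max (w x⁻¹) 1 ^ w.mult ≤ ∏ v : InfinitePlace K, max (v x⁻¹) 1 ^ v.mult := by
    classical
    set F : InfinitePlace K → ℝ := fun v => max (v x⁻¹) 1 ^ v.mult with hF
    have hF1 : ∀ v, 1 ≤ F v := fun v => one_le_pow₀ (le_max_right _ _)
    have hrest : (1 : ℝ) ≤ ∏ v ∈ Finset.univ.erase w, F v := by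
      have h := Finset.prod_le_prod (s := Finset.univ.erase w) (f := fun _ => (1 : ℝ)) (g := F)
        (fun _ _ => zero_le_one) (fun v _ => hF1 v)
      rwa [Finset.prod_const_one] at h
    change F w ≤ ∏ v, F v
    rw [← Finset.mul_prod_erase Finset.univ F (Finset.mem_univ w)]
    exact le_mul_of_one_le_right (zero_le_one.trans (hF1 w)) hrest
  have h3 : (1 : ℝ) ≤ ∏ᶠ v : FinitePlace K, max (v x⁻¹) 1 :=
    one_le_finprod fun v => le_max_right _ _
  have h4 : ‖φ x‖⁻¹ ≤ mulHeight₁ x := by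
    rw [← mulHeight₁_inv, NumberField.mulHeight₁_eq]
    calc ‖φ x‖⁻¹ ≤ ∏ v : InfinitePlace K, max (v x⁻¹) 1 ^ v.mult := h1.trans h2
      _ = (∏ v : InfinitePlace K, max (v x⁻¹) 1 ^ v.mult) * 1 := (mul_one _).symm
      _ ≤ (∏ v : InfinitePlace K, max (v x⁻¹) 1 ^ v.mult) * ∏ᶠ v : FinitePlace K, max (v x⁻¹) 1 := by
          refine mul_le_mul_of_nonneg_left h3 ?_
          exact Finset.prod_nonneg fun v _ => by positivity
  rw [inv_le_comm₀ (mulHeight₁_pos x) hpos]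
  exact h4

/-- Logarithmic form: `−log H_K(x) ≤ log ‖φ x‖` for `x ≠ 0`. [folklore] -/
theorem neg_logHeight₁_le_log_norm_embedding (φ : K →+* ℂ) {x : K} (hx : x ≠ 0) :
    -logHeight₁ x ≤ Real.log ‖φ x‖ := by
  have h := inv_mulHeight₁_le_norm_embedding φ hx
  rw [logHeight₁_eq_log_mulHeight₁, ← Real.log_inv]
  exact Real.log_le_log (inv_pos.mpr (mulHeight₁_pos x)) h

end numberField

/-! ### Liouville's inequality for `∑ a_l β^{e₁ l} ξ^{e₂ l}` in a number field `F ⊂ ℂ` -/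

/-- **Liouville's inequality for an integer polynomial in two algebraic numbers**
([NesterenkoWaldschmidt1996, Lemma 5] with `n = 2`, weakened to `D' = D` and `D − 1 ↦ D`).
Let `F ⊂ ℂ` be a subfield finite over `ℚ`, `β, ξ ∈ F`, and `v = ∑_{l ∈ s} a_l β^{e₁ l} ξ^{e₂ l}`
with `a_l ∈ ℤ`, `e₁ l ≤ D₁`, `e₂ l ≤ D₂`. If `v ≠ 0` then
`log |v| ≥ −[F:ℚ] · (log max(1, ∑|a_l|) + D₁ h(β) + D₂ h(ξ))`, `h = weilHeight₁ F` the absolute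
logarithmic Weil height. [cite: NesterenkoWaldschmidt1996, §5 Lemma 5] -/
theorem liouville₂ (F : IntermediateField ℚ ℂ) [FiniteDimensional ℚ F] {β ξ : ℂ} (hβ : β ∈ F)
    (hξ : ξ ∈ F) {ι : Type*} (s : Finset ι) (a : ι → ℤ) (e₁ e₂ : ι → ℕ) {D₁ D₂ : ℕ}
    (hD : ∀ l ∈ s, e₁ l ≤ D₁ ∧ e₂ l ≤ D₂)
    (hv : ∑ l ∈ s, (a l : ℂ) * β ^ e₁ l * ξ ^ e₂ l ≠ 0) :
    -((Module.finrank ℚ F : ℝ) * (Real.log (max 1 (∑ l ∈ s, |(a l : ℝ)|)) +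
        D₁ * weilHeight₁ F (fun _ : Unit => β) + D₂ * weilHeight₁ F (fun _ : Unit => ξ))) ≤
      Real.log ‖∑ l ∈ s, (a l : ℂ) * β ^ e₁ l * ξ ^ e₂ l‖ := by
  haveI : NumberField F := numberField_of_intermediateField F
  set β' : F := ⟨β, hβ⟩ with hβ'
  set ξ' : F := ⟨ξ, hξ⟩ with hξ'
  set v' : F := ∑ l ∈ s, (a l : F) * β' ^ e₁ l * ξ' ^ e₂ l with hv'
  have hcoe : (algebraMap F ℂ) v' = ∑ l ∈ s, (a l : ℂ) * β ^ e₁ l * ξ ^ e₂ l := by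
    rw [hv', map_sum]
    refine Finset.sum_congr rfl fun l _ => ?_
    rw [map_mul, map_mul, map_pow, map_pow, map_intCast]
    rfl
  have hv'0 : v' ≠ 0 := by
    intro h
    apply hv
    rw [← hcoe, h, map_zero]
  -- Liouville: `−logHeight₁ v' ≤ log |v|`
  have hL := neg_logHeight₁_le_log_norm_embedding (algebraMap F ℂ : F →+* ℂ) hv'0
  rw [hcoe] at hL
  refine le_trans ?_ hL
  rw [neg_le_neg_iff]
  -- the height of `v'`
  have hH := logHeight₁_sum_intCast_mul_pow_mul_pow_le s a e₁ e₂ β' ξ' hD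
  refine hH.trans (le_of_eq ?_)
  have hfin : (0 : ℝ) < Module.finrank ℚ F := by exact_mod_cast Module.finrank_pos
  have eβ : logHeight₁ β' = Module.finrank ℚ F * weilHeight₁ F (fun _ : Unit => β) := by
    rw [weilHeight₁_single_eq F hβ, show (⟨β, hβ⟩ : F) = β' from rfl]; field_simp
  have eξ : logHeight₁ ξ' = Module.finrank ℚ F * weilHeight₁ F (fun _ : Unit => ξ) := by
    rw [weilHeight₁_single_eq F hξ, show (⟨ξ, hξ⟩ : F) = ξ' from rfl]; field_simp
  rw [eβ, eξ]; ring

end Waldschmidt1978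

end Literature.NumberTheory.Transcendental

end
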